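import Literature.AnabelianGeometry.EtaleTheta.Discharge.Sec3Cor38Criterion
import Literature.AnabelianGeometry.EtaleTheta.RealificationOrder
import Literature.AlgebraicGeometry.Frobenioids.RealificationMapInjectiveFiniteSupp
import HarnessLib

/-!
# [EtTh] Corollary 3.8 (i) sub-DAG — row C38-L05, part (d) at the TREE vocabulary WITHOUT the binder `hSup`:
# base-field-theoretic ⟺ supremum of O^▷-divisors, read COORDINATEWISE

Mochizuki, *The étale theta function …*, Publ. RIMS **45** (2009), Cor. 3.8, proof PDF p.81 l.20–27
[cite: MochizukiEtTh2009, Cor 3.8 p.81]: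

> "Now observe [cf. Proposition 3.4, (ii); the equivalences of categories of [Mzk17], Definition 1.3, (iii), (d),
> determined by the operation of taking the zero divisor of a co-angular pre-step] that a pre-step of `C_i` is
> base-field-theoretic if and only if its image `A → B` in `C_i^pf` may be written as a [filtered] projective limit
> in the category `(C_i^pf)^coa-pre_B` … of pre-steps `A' → B` that are abstractly equivalent [cf. §0] to an
> endomorphism that belongs to '`O^▷(−)`'."

and [FrdI] Def. 1.3 (iii)(d) / Def. 2.4 (i) (kurims pp.24, 47–48) [cite: MochizukiFrdI2008, Def. 2.4(i) p.47]:
limits in `(C^pf)^coa-pre_B ≃ Order(Φ(B)^pf)ᵒᵖ` are suprema for `∣`, and divisibility in the perfection of a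
perf-factorial monoid is read prime-by-prime in `∏_𝔮 M^rlf_𝔮`.

abc-iut cell, layer L2, seat abc-iut-w4-d084 (row «C38-L05d-coord», abc-iut-L2-lead ROWS #13-addendum (3),
2026-08-26T06:05Z; GAP-LEDGER G-w5d124-3 / D-G-w5d124-3).  Companion of `Discharge/Sec3Cor38Criterion.lean`
(seat abc-iut-w5-d124), whose part (d) `isBaseFieldTheoreticDiv_iff_isLUB_divOPf` consumes THREE printed
properties of the Def. 3.3/3.6 (i) data as binders: `hP34Λ` (Prop. 3.4 (ii) at monoid type `Λ` — now the typed
field `Prop34Cnst.mem_FΛ_of_divΛ_eq_of`, and a THEOREM at the constructed data `ofRlfZ/ofRlfQ`), `hNZ`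
(Def. 3.6 (ii)(b), bracketed consequence) and `hSup` (existence of suprema ALONG the line `ℝ·Φ₀^cnst`).  The
cell found (D-G-w5d124-3) that `hSup` is not derivable and not true for general typed data.  THIS FILE removes
it when the monoid vocabulary is the tree's (`treeMonoidVocab`: `V.IsPerfFactorial = IsPerfFactorial`, so the
divisor monoids `Φ(W)` carry the coordinates of [FrdI] Def. 2.4 (i)), under two side conditions on the data
at `W`, both printed-and-automatic for tempered Frobenioids of monoid type `Λ ∈ {ℤ, ℚ}` built from integral
log-divisors:
* `hΛ` — `Φ^{bs-fld}(W)` is monoprime OF TYPE `ℤ` OR `ℚ` (the typed field `isMonoprime_bsFld` allows the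
  third type `ℝ`): any two base-field-theoretic elements are COMMENSURABLE (`l^a = Z₀^b`);
* `hQ` — the localized perfections `Φ(W)^pf_𝔮` are `ℚ`-monoprime ([FrdI] §0: `M_𝔭 ≅ ℤ_{≥0}` for a monoid of
  effective ℤ-divisors): in coordinates every element of `Φ(W)^pf` is a RATIONAL point.
Then, GIVEN `hP34Λ` and `hNZ` only:
* (⇒) a base-field-theoretic `x` is commensurable with the nontrivial O^▷-divisor `Z₀` of `hNZ`, so `x^{1/1}`
  ITSELF is a root of an O^▷-divisor (`of_mem_divOPf_of_isBaseFieldTheoreticDiv`) and `{x^{1/1}}` is the family;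
* (⇐) if `x^{1/1}` is the least upper bound of a nonempty family `S` of roots of O^▷-divisors, then in the
  coordinates `κ : Φ(W)^pf ↪ ∏_𝔮 ℝ_{≥0}` (order embedding, `exists_pfCoord`) every `s ∈ S` is `t_s · w`
  (`w` = coordinates of `Z₀`, `t_s ∈ ℚ_{≥0}`), `κ(x) ≥ sup_s t_s · w`, and `κ(x) ≤ r · w` for every rational
  `r > α := sup_s t_s` (test the upper bound `Z₀^r` of `S`), so `κ(x) = α · w`; by `hQ` the ratio `α` is
  rational, `α = p/q`, whence `x^{1/1} = (Z₀^p)^{1/q}` (`κ` injective) and `x` is base-field-theoretic.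
* `isBaseFieldTheoreticDiv_iff_isLUB_divOPf_coord`, and the row **`bsFldPreStepLimitCriterion_of_coord`** —
  `C.BsFldPreStepLimitCriterion (perfection hF)` from `hF`, `hP34Λ`, `hNZ`, `hΛ`, `hQ` (NO `hSup`).
HONEST FRAMING: refereed pre-IUT material; nothing here bears on [IUTchIII] Cor. 3.12; typed ≠ proved elsewhere.
-/

namespace Literature.AnabelianGeometry.EtaleTheta

open CategoryTheory Opposite Function NNReal Literature.AlgebraicGeometry.Frobenioids

universe u₀ v₀ u v w

/-! ### §1 Coordinates on the perfection of a perf-factorial monoid -/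

namespace Cor38Coord

variable {M : Type w} [CommMonoid M]

/-- **Coordinates on `M^pf`** for a perf-factorial `M` ([FrdI] Def. 2.4 (i): `M^pf ↪ M^rlf ⊆ ∏_𝔮 M^rlf_𝔮`,
each `M^rlf_𝔮 ≅ ℝ_{≥0}`): an injective homomorphism `κ : M^pf → ∏_𝔮 ℝ_{≥0}` which is an ORDER EMBEDDING for
`∣`, and at every prime `𝔮` whose localized perfection `M^pf_𝔮` is `ℚ`-monoprime the `𝔮`-coordinates of all
elements are rational multiples of one nonzero real. [cite: MochizukiFrdI2008, Def. 2.4(i) p.47] -/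
theorem exists_pfCoord (hM : IsPerfFactorial M) :
    ∃ κ : Perfection M →* (Primes (Perfection M) → Multiplicative ℝ≥0),
      Injective κ ∧ (∀ a b : Perfection M, a ∣ b ↔ κ a ≤ κ b) ∧
      ∀ 𝔮 : Primes (Perfection M), IsQMonoprime (PfAt M 𝔮) →
        ∃ c : ℝ≥0, c ≠ 0 ∧ ∀ a : Perfection M, ∃ q : ℚ≥0, Multiplicative.toAdd (κ a 𝔮) = c * (q : ℝ≥0) := by
  classical
  have hb : ∀ 𝔮 : Primes (Perfection M), IsMonoprime (PfAt M 𝔮) :=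
    fun 𝔮 => PerfectionPrimes.isMonoprime_pfAt hM 𝔮
  let f : ∀ 𝔮 : Primes (Perfection M), RlfAt M 𝔮 ≃* Multiplicative ℝ≥0 :=
    fun 𝔮 => Classical.choice (RealificationCoord.nonempty_coord (hb 𝔮))
  let Fe : RlfFactor M ≃* (Primes (Perfection M) → Multiplicative ℝ≥0) := MulEquiv.piCongrRight f
  let κ : Perfection M →* (Primes (Perfection M) → Multiplicative ℝ≥0) := Fe.toMonoidHom.comp hM.factorHom
  have hκ : ∀ (a : Perfection M) (𝔮 : Primes (Perfection M)), κ a 𝔮 = f 𝔮 (factorMap M a 𝔮) := fun _ _ => rfl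
  refine ⟨κ, fun a b h => hM.factorMap_injective (Fe.injective h), fun a b => ?_, fun 𝔮 h𝔮 => ?_⟩
  · -- `a ∣ b` ⟺ `ι a ∣ ι b` in `M^rlf` ⟺ prime by prime ⟺ `κ a ≤ κ b`
    rw [← RlfCoord.toRealification_dvd_iff hM hb a b, IsPerfFactorial.Rlf.dvd_iff]
    change (∀ 𝔮, factorMap M a 𝔮 ∣ factorMap M b 𝔮) ↔ _
    constructor
    · intro h 𝔮
      rw [hκ, hκ]
      exact (RealificationCoord.mnnreal_dvd_iff_le _ _).mp (map_dvd (f 𝔮) (h 𝔮))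
    · intro h 𝔮
      have h' : f 𝔮 (factorMap M a 𝔮) ∣ f 𝔮 (factorMap M b 𝔮) :=
        (RealificationCoord.mnnreal_dvd_iff_le _ _).mpr (by rw [← hκ, ← hκ]; exact h 𝔮)
      exact (map_dvd_iff (f 𝔮)).mp h'
  · -- rational coordinates at a `ℚ`-monoprime prime: `factorMap a 𝔮 = of (x_𝔮)` and the chart is a homothety
    obtain ⟨⟨e⟩⟩ := h𝔮
    obtain ⟨c, hc, hg⟩ := RealificationCoord.chart_Q (f 𝔮) e
    refine ⟨c, hc, fun a => ?_⟩
    obtain ⟨xF, hxF⟩ := hM.factorMap_mem_range a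
    have h1 : factorMap M a 𝔮 = Realification.of (PfAt M 𝔮) (xF 𝔮) := by
      rw [← hxF]; rfl
    refine ⟨Multiplicative.toAdd (e (xF 𝔮)), ?_⟩
    rw [hκ, h1, hg]


/-! ### §2 Commensurability in a monoprime monoid of type `ℤ` or `ℚ` -/

/-- In a monoid isomorphic to `ℤ_{≥0}`, any element is commensurable with any nontrivial one:
`l^a = z^b` with `a ≥ 1`. [cite: MochizukiFrdI2008, §0 p.10] -/
theorem exists_pow_eq_pow_of_mulEquiv_nat {L : Type*} [CommMonoid L] (e : L ≃* Multiplicative ℕ)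
    (l z : L) (hz : z ≠ 1) : ∃ a b : ℕ, 0 < a ∧ l ^ a = z ^ b := by
  refine ⟨Multiplicative.toAdd (e z), Multiplicative.toAdd (e l), ?_, e.injective ?_⟩
  · refine Nat.pos_of_ne_zero fun h => hz ?_
    apply e.injective
    rw [map_one]
    exact Multiplicative.toAdd.injective (by rw [h, toAdd_one])
  · rw [map_pow, map_pow]
    apply Multiplicative.toAdd.injective
    rw [toAdd_pow, toAdd_pow, smul_eq_mul, smul_eq_mul, mul_comm]

/-- In a monoid isomorphic to `ℚ_{≥0}`, any element is commensurable with any nontrivial one: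
`l^a = z^b` with `a ≥ 1` (clear denominators). [cite: MochizukiFrdI2008, §0 p.10] -/
theorem exists_pow_eq_pow_of_mulEquiv_nnrat {L : Type*} [CommMonoid L] (e : L ≃* Multiplicative ℚ≥0)
    (l z : L) (hz : z ≠ 1) : ∃ a b : ℕ, 0 < a ∧ l ^ a = z ^ b := by
  set r : ℚ≥0 := Multiplicative.toAdd (e l) with hr
  set s : ℚ≥0 := Multiplicative.toAdd (e z) with hs
  have hs0 : s ≠ 0 := by
    intro h
    apply hz
    apply e.injective
    rw [map_one]
    exact Multiplicative.toAdd.injective (by rw [← hs, h, toAdd_one])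
  refine ⟨r.den * s.num, r.num * s.den, Nat.mul_pos r.den_pos (NNRat.num_pos.mpr (pos_iff_ne_zero.mpr hs0)),
    e.injective ?_⟩
  rw [map_pow, map_pow]
  apply Multiplicative.toAdd.injective
  rw [toAdd_pow, toAdd_pow, nsmul_eq_mul, nsmul_eq_mul, ← hr, ← hs, Nat.cast_mul, Nat.cast_mul,
    mul_comm (r.den : ℚ≥0), mul_assoc, NNRat.den_mul_eq_num, mul_assoc, NNRat.den_mul_eq_num,
    mul_comm]

/-- Commensurability in a monoprime monoid of type `ℤ` or `ℚ`. [cite: MochizukiFrdI2008, §0 p.10] -/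
theorem exists_pow_eq_pow_of_ZQ {L : Type w} [CommMonoid L] (hΛ : IsZMonoprime L ∨ IsQMonoprime L)
    (l z : L) (hz : z ≠ 1) : ∃ a b : ℕ, 0 < a ∧ l ^ a = z ^ b := by
  rcases hΛ with ⟨⟨⟨e⟩⟩⟩ | ⟨⟨⟨e⟩⟩⟩
  · exact exists_pow_eq_pow_of_mulEquiv_nat e l z hz
  · exact exists_pow_eq_pow_of_mulEquiv_nnrat e l z hz

end Cor38Coord

/-! ### §3 Base-field-theoretic elements of a tempered Frobenioid whose line is of type `ℤ` or `ℚ` -/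

variable {D₀ : Type u₀} [Category.{v₀} D₀] {V : FrdIMonoidStub.{w}}
  {T : RealifiedDivisorMonoids (D₀ := D₀) V} {D : Type u} [Category.{v} D] {VD : FrdICatStub.{u, v, w} D}

namespace TemperedFrobenioid

variable {C : TemperedFrobenioid T D VD}

/-- **Commensurability of base-field-theoretic divisors**: if `Φ^{bs-fld}(W)` is monoprime of type `ℤ` or `ℚ`,
then for base-field-theoretic `l, z ∈ Φ(W)` with `z ≠ 1` there are `a ≥ 1`, `b` with `l^a = z^b` in `Φ(W)`.
[cite: MochizukiEtTh2009, Def 3.6 p.77] -/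
theorem exists_pow_eq_pow_of_isBaseFieldTheoreticDiv {A : Dᵒᵖ}
    (hΛ : IsZMonoprime ↥(C.bsFld.carrier A) ∨ IsQMonoprime ↥(C.bsFld.carrier A))
    {l z : C.Φ.carrier A} (hl : C.IsBaseFieldTheoreticDiv l) (hz : C.IsBaseFieldTheoreticDiv z)
    (hz1 : z ≠ 1) : ∃ a b : ℕ, 0 < a ∧ l ^ a = z ^ b := by
  have hz1' : (⟨(z : C.ΦRlog.obj A), hz⟩ : C.bsFld.carrier A) ≠ 1 := by
    intro h
    apply hz1
    exact Subtype.ext (congrArg Subtype.val h :)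
  obtain ⟨a, b, ha, hab⟩ :=
    Cor38Coord.exists_pow_eq_pow_of_ZQ hΛ ⟨(l : C.ΦRlog.obj A), hl⟩ ⟨(z : C.ΦRlog.obj A), hz⟩ hz1'
  refine ⟨a, b, ha, Subtype.ext ?_⟩
  have h := congrArg Subtype.val hab
  simp only [SubmonoidClass.coe_pow] at h
  rw [SubmonoidClass.coe_pow, SubmonoidClass.coe_pow]
  exact h

/-- **(⇒), the whole point under commensurability**: a base-field-theoretic `x ∈ Φ(W)` is commensurable with the
nontrivial O^▷-divisor `Z₀` — `x^a = Z₀^b`, `a ≥ 1` — so `x^{1/1} = (Z₀^b)^{1/a}` is ITSELF a root of an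
O^▷-divisor: `x^{1/1} ∈ divOPf C W`. [cite: MochizukiEtTh2009, Cor 3.8 p.81] -/
theorem of_mem_divOPf_of_isBaseFieldTheoreticDiv {W : D}
    (hΛ : IsZMonoprime ↥(C.bsFld.carrier (op W)) ∨ IsQMonoprime ↥(C.bsFld.carrier (op W)))
    {Z₀ : C.Φ.carrier (op W)} (hZ₀ : Z₀ ∈ C.divO W) (hZ₀b : C.IsBaseFieldTheoreticDiv Z₀) (hZ₀1 : Z₀ ≠ 1)
    {x : C.Φ.carrier (op W)} (hx : C.IsBaseFieldTheoreticDiv x) :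
    Perfection.of _ x ∈ C.divOPf W := by
  obtain ⟨a, b, ha, hab⟩ := exists_pow_eq_pow_of_isBaseFieldTheoreticDiv hΛ hx hZ₀b hZ₀1
  let a' : ℕ+ := ⟨a, ha⟩
  have h1 : Perfection.of _ x = Perfection.mk (x ^ (a' : ℕ)) a' := by
    rw [Perfection.of_apply, ← Perfection.mk_pow_mul x 1 a', one_mul]
  refine ⟨Z₀ ^ b, a', pow_mem_divO hZ₀ b, ?_⟩
  rw [h1]
  exact congrArg (Perfection.mk · a') hab


/-! ### §4 The coordinate argument (tree vocabulary): an LUB of roots of O^▷-divisors lies on the line -/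

section Tree

variable {T' : RealifiedDivisorMonoids (D₀ := D₀) treeMonoidVocab.{w}} {C : TemperedFrobenioid T' D VD}

/-- At the tree vocabulary the divisor monoid `Φ(W)` of a tempered Frobenioid IS perf-factorial in the sense of
[FrdI] Def. 2.4 (i) (the typed field `isPerfFactorial` read through `treeMonoidVocab`). [cite: MochizukiEtTh2009, Def 3.6 p.77] -/
theorem isPerfFactorial_divisorMonoid (W : D) : IsPerfFactorial (C.divisorMonoid.obj (op W)) :=
  C.isPerfFactorial (op W)

/-- A nonnegative real below `b + c/n` for every `n ≥ 1` is `≤ b`. [folklore] -/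
private theorem nnreal_le_of_forall_le_add_div {a b c : ℝ≥0} (h : ∀ n : ℕ, 0 < n → a ≤ b + c / n) :
    a ≤ b := by
  refine le_of_forall_pos_le_add fun ε hε => ?_
  obtain ⟨n, hn⟩ := exists_nat_gt (c / ε)
  have hn1 : c / ε < ((n + 1 : ℕ) : ℝ≥0) := hn.trans (by exact_mod_cast Nat.lt_succ_self n)
  have hpos : (0 : ℝ≥0) < ((n + 1 : ℕ) : ℝ≥0) := by exact_mod_cast Nat.succ_pos n
  have hcn : c / ((n + 1 : ℕ) : ℝ≥0) ≤ ε := by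
    rw [div_le_iff₀ hpos]
    rw [div_lt_iff₀ hε, mul_comm] at hn1
    exact hn1.le
  exact (h (n + 1) (Nat.succ_pos n)).trans (add_le_add le_rfl hcn)

/-- **Part (d), direction (⇐), at the tree vocabulary and WITHOUT `hSup`.**  If `Φ^{bs-fld}(W)` is of type `ℤ` or
`ℚ` (`hΛ`), the localized perfections of `Φ(W)` are `ℚ`-monoprime (`hQ`), `Z₀ ≠ 1` is base-field-theoretic, and
`x^{1/1}` is the least upper bound in `Φ(W)^pf` of a nonempty family `S` of roots of base-field-theoretic elements
each dividing `x^{1/1}`, then `x` is base-field-theoretic: in the coordinates `κ : Φ(W)^pf ↪ ∏_𝔮 ℝ_{≥0}` of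
[FrdI] Def. 2.4 (i) one has `κ(s) = t_s·κ(Z₀)` for `s ∈ S`, `κ(x) = α·κ(Z₀)` with `α = sup t_s` (test `x`
against the upper bounds `(Z₀^p)^{1/N}` of `S`, `p/N ↓ α`), and `α = p/q` is rational (`hQ`), whence
`x^{1/1} = (Z₀^p)^{1/q}`. [cite: MochizukiEtTh2009, Cor 3.8 p.81] -/
theorem isBaseFieldTheoreticDiv_of_isLUB_bsFldPf {W : D}
    (hΛ : IsZMonoprime ↥(C.bsFld.carrier (op W)) ∨ IsQMonoprime ↥(C.bsFld.carrier (op W)))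
    (hQ : ∀ 𝔮 : Primes (Perfection (C.divisorMonoid.obj (op W))),
      IsQMonoprime (PfAt (C.divisorMonoid.obj (op W)) 𝔮))
    {Z₀ : C.divisorMonoid.obj (op W)} (hZ₀b : C.IsBaseFieldTheoreticDiv Z₀) (hZ₀1 : Z₀ ≠ 1)
    (x : C.divisorMonoid.obj (op W)) {S : Set (Perfection (C.divisorMonoid.obj (op W)))}
    (hS : S ⊆ C.bsFldPf W) (hne : S.Nonempty)
    (hbd : ∀ s ∈ S, s ∣ Perfection.of (C.divisorMonoid.obj (op W)) x)
    (hlub : ∀ z, (∀ s ∈ S, s ∣ z) → Perfection.of (C.divisorMonoid.obj (op W)) x ∣ z) :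
    C.IsBaseFieldTheoreticDiv x := by
  classical
  have hM : IsPerfFactorial (C.divisorMonoid.obj (op W)) := isPerfFactorial_divisorMonoid W
  obtain ⟨κ, hinj, hord, hrat⟩ := Cor38Coord.exists_pfCoord hM
  -- additive coordinates
  let X : Perfection (C.divisorMonoid.obj (op W)) → Primes (Perfection (C.divisorMonoid.obj (op W))) → ℝ≥0 :=
    fun a 𝔮 => Multiplicative.toAdd (κ a 𝔮)
  have hXpow : ∀ a (n : ℕ) 𝔮, X (a ^ n) 𝔮 = n * X a 𝔮 := by
    intro a n 𝔮
    change Multiplicative.toAdd (κ (a ^ n) 𝔮) = n * Multiplicative.toAdd (κ a 𝔮)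
    rw [map_pow, Pi.pow_apply, toAdd_pow, nsmul_eq_mul]
  have hXle : ∀ a b, a ∣ b ↔ ∀ 𝔮, X a 𝔮 ≤ X b 𝔮 := by
    intro a b
    rw [hord a b, Pi.le_def]
    exact forall_congr' fun 𝔮 => (Multiplicative.toAdd_le).symm
  have hXinj : ∀ a b, (∀ 𝔮, X a 𝔮 = X b 𝔮) → a = b := by
    intro a b h
    exact hinj (funext fun 𝔮 => Multiplicative.toAdd.injective (h 𝔮))
  -- the direction `w` of the line and a prime where it is visible
  let w : Primes (Perfection (C.divisorMonoid.obj (op W))) → ℝ≥0 :=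
    X (Perfection.of (C.divisorMonoid.obj (op W)) Z₀)
  have hw0 : ∃ 𝔮₀, w 𝔮₀ ≠ 0 := by
    by_contra hall
    apply hZ₀1
    have h1 : Perfection.of (C.divisorMonoid.obj (op W)) Z₀ = 1 :=
      hXinj _ _ fun 𝔮 => by
        have hw : w 𝔮 = 0 := not_not.mp (not_exists.mp hall 𝔮)
        change w 𝔮 = Multiplicative.toAdd (κ 1 𝔮)
        rw [map_one, Pi.one_apply, toAdd_one]
        exact hw
    exact (Perfection.mk_eq_one_iff_of_isSharp hM.isDivisorial.isSharp).mp h1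
  obtain ⟨𝔮₀, h𝔮₀⟩ := hw0
  -- roots of powers of `Z₀` in coordinates: `X ((Z₀^p)^{1/N}) = (p/N) · w`
  have hroot : ∀ (p : ℕ) (N : ℕ+) 𝔮, X (Perfection.mk (Z₀ ^ p) N) 𝔮 = (p : ℝ≥0) / N * w 𝔮 := by
    intro p N 𝔮
    have h := hXpow (Perfection.mk (Z₀ ^ p) N) N 𝔮
    rw [Perfection.mk_pow_self, map_pow, hXpow] at h
    -- `h : p * w 𝔮 = N * X (mk (Z₀^p) N) 𝔮`
    have hN : (N : ℝ≥0) ≠ 0 := by exact_mod_cast N.ne_zero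
    rw [div_mul_eq_mul_div, eq_div_iff hN, mul_comm]
    exact h.symm
  -- every `s ∈ S` lies on the line: `X s = t_s · w` with `t_s ≥ 0`
  have hline : ∀ s ∈ S, ∃ t : ℝ≥0, ∀ 𝔮, X s 𝔮 = t * w 𝔮 := by
    intro s hs
    obtain ⟨l, N, hl, rfl⟩ := hS hs
    obtain ⟨a, b, ha, hab⟩ := exists_pow_eq_pow_of_isBaseFieldTheoreticDiv hΛ hl hZ₀b hZ₀1
    refine ⟨(b : ℝ≥0) / ((N : ℕ) * a : ℕ), fun 𝔮 => ?_⟩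
    have hpow : Perfection.mk l N ^ ((N : ℕ) * a) = Perfection.of (C.divisorMonoid.obj (op W)) (Z₀ ^ b) := by
      rw [pow_mul, Perfection.mk_pow_self, ← map_pow]
      exact congrArg (Perfection.of (C.divisorMonoid.obj (op W))) hab
    have h : X (Perfection.mk l N ^ ((N : ℕ) * a)) 𝔮 = X (Perfection.of (C.divisorMonoid.obj (op W)) (Z₀ ^ b)) 𝔮 := by
      rw [hpow]
    rw [hXpow, map_pow, hXpow] at h
    have hNa : (((N : ℕ) * a : ℕ) : ℝ≥0) ≠ 0 := by exact_mod_cast (Nat.mul_pos N.pos ha).ne'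
    rw [div_mul_eq_mul_div, eq_div_iff hNa, mul_comm]
    exact h
  choose t ht using hline
  -- the supremum of the line coordinates of `S`
  let tS : Set ℝ≥0 := {r | ∃ (s : _) (hs : s ∈ S), r = t s hs}
  have htS_ne : tS.Nonempty := by obtain ⟨s, hs⟩ := hne; exact ⟨t s hs, s, hs, rfl⟩
  have hXx_ge : ∀ s (hs : s ∈ S) 𝔮, t s hs * w 𝔮 ≤ X (Perfection.of (C.divisorMonoid.obj (op W)) x) 𝔮 := by
    intro s hs 𝔮
    rw [← ht s hs 𝔮]
    exact (hXle _ _).mp (hbd s hs) 𝔮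
  have htS_bdd : BddAbove tS := by
    refine ⟨X (Perfection.of (C.divisorMonoid.obj (op W)) x) 𝔮₀ / w 𝔮₀, ?_⟩
    rintro _ ⟨s, hs, rfl⟩
    rw [le_div_iff₀ (pos_iff_ne_zero.mpr h𝔮₀)]
    exact hXx_ge s hs 𝔮₀
  set α : ℝ≥0 := sSup tS with hα
  have ht_le : ∀ s (hs : s ∈ S), t s hs ≤ α := fun s hs => le_csSup htS_bdd ⟨s, hs, rfl⟩
  -- lower bound: `α · w ≤ X x`
  have hlow : ∀ 𝔮, α * w 𝔮 ≤ X (Perfection.of (C.divisorMonoid.obj (op W)) x) 𝔮 := by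
    intro 𝔮
    by_cases hw : w 𝔮 = 0
    · rw [hw, mul_zero]; exact zero_le
    · rw [← le_div_iff₀ (pos_iff_ne_zero.mpr hw)]
      refine csSup_le htS_ne ?_
      rintro _ ⟨s, hs, rfl⟩
      rw [le_div_iff₀ (pos_iff_ne_zero.mpr hw)]
      exact hXx_ge s hs 𝔮
  -- upper bound: `X x ≤ (p/N) · w` whenever `α < p/N`, by testing the upper bound `(Z₀^p)^{1/N}` of `S`
  have hup' : ∀ (p : ℕ) (N : ℕ+), α < (p : ℝ≥0) / N →
      ∀ 𝔮, X (Perfection.of (C.divisorMonoid.obj (op W)) x) 𝔮 ≤ (p : ℝ≥0) / N * w 𝔮 := by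
    intro p N hpN
    have hz : ∀ s ∈ S, s ∣ Perfection.mk (Z₀ ^ p) N := by
      intro s hs
      refine (hXle _ _).mpr fun 𝔮 => ?_
      rw [ht s hs 𝔮, hroot]
      exact mul_le_mul_of_nonneg_right ((ht_le s hs).trans hpN.le) zero_le
    intro 𝔮
    rw [← hroot]
    exact (hXle _ _).mp (hlub _ hz) 𝔮
  have hup : ∀ 𝔮, X (Perfection.of (C.divisorMonoid.obj (op W)) x) 𝔮 ≤ α * w 𝔮 := by
    intro 𝔮
    refine nnreal_le_of_forall_le_add_div (c := w 𝔮) fun N hN => ?_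
    -- `p := ⌊α N⌋ + 1`, so that `α < p/N ≤ α + 1/N`
    let N' : ℕ+ := ⟨N, hN⟩
    let p : ℕ := ⌊α * N⌋₊ + 1
    have hNN : ((N' : ℕ) : ℝ≥0) = (N : ℝ≥0) := rfl
    have hNpos : (0 : ℝ≥0) < (N : ℝ≥0) := by exact_mod_cast hN
    have h1 : α < (p : ℝ≥0) / (N' : ℕ) := by
      rw [hNN, lt_div_iff₀ hNpos]
      show α * (N : ℝ≥0) < ((⌊α * (N : ℝ≥0)⌋₊ + 1 : ℕ) : ℝ≥0)
      push_cast
      exact Nat.lt_floor_add_one _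
    have h2 : (p : ℝ≥0) / (N' : ℕ) ≤ α + 1 / N := by
      rw [hNN, div_le_iff₀ hNpos, add_mul, one_div, inv_mul_cancel₀ hNpos.ne']
      show ((⌊α * (N : ℝ≥0)⌋₊ + 1 : ℕ) : ℝ≥0) ≤ α * (N : ℝ≥0) + 1
      push_cast
      exact add_le_add (Nat.floor_le zero_le) le_rfl
    calc X (Perfection.of (C.divisorMonoid.obj (op W)) x) 𝔮 ≤ (p : ℝ≥0) / (N' : ℕ) * w 𝔮 := hup' p N' h1 𝔮
      _ ≤ (α + 1 / N) * w 𝔮 := mul_le_mul_of_nonneg_right h2 zero_le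
      _ = α * w 𝔮 + w 𝔮 / N := by rw [add_mul, one_div, inv_mul_eq_div]
  have hXx : ∀ 𝔮, X (Perfection.of (C.divisorMonoid.obj (op W)) x) 𝔮 = α * w 𝔮 :=
    fun 𝔮 => le_antisymm (hup 𝔮) (hlow 𝔮)
  -- rationality of `α` from the `ℚ`-monoprime prime `𝔮₀`
  obtain ⟨c, hc, hcq⟩ := hrat 𝔮₀ (hQ 𝔮₀)
  obtain ⟨q₁, hq₁⟩ := hcq (Perfection.of (C.divisorMonoid.obj (op W)) x)
  obtain ⟨q₂, hq₂⟩ := hcq (Perfection.of (C.divisorMonoid.obj (op W)) Z₀)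
  change X (Perfection.of (C.divisorMonoid.obj (op W)) x) 𝔮₀ = c * q₁ at hq₁
  change w 𝔮₀ = c * q₂ at hq₂
  have hq₂0 : q₂ ≠ 0 := by
    intro h; apply h𝔮₀; rw [hq₂, h, NNRat.cast_zero, mul_zero]
  have hq₂0' : ((q₂ : ℚ≥0) : ℝ≥0) ≠ 0 := by exact_mod_cast hq₂0
  set ρ : ℚ≥0 := q₁ / q₂ with hρ
  have hαq : α = (ρ : ℝ≥0) := by
    have h := hXx 𝔮₀
    rw [hq₁, hq₂, ← mul_assoc, mul_comm α c, mul_assoc] at h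
    have h' : ((q₁ : ℚ≥0) : ℝ≥0) = α * q₂ := mul_left_cancel₀ hc h
    rw [hρ, NNRat.cast_div, eq_div_iff hq₂0', h']
  -- `α = num/den`
  let qd : ℕ+ := ⟨ρ.den, ρ.den_pos⟩
  have hαpq : α = (ρ.num : ℝ≥0) / (qd : ℕ) := by
    have h := NNRat.den_mul_eq_num ρ
    have h' : ((ρ.den : ℚ≥0) : ℝ≥0) * (ρ : ℝ≥0) = ((ρ.num : ℚ≥0) : ℝ≥0) := by rw [← NNRat.cast_mul, h]
    rw [NNRat.cast_natCast, NNRat.cast_natCast] at h'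
    have hden : ((qd : ℕ) : ℝ≥0) ≠ 0 := by exact_mod_cast ρ.den_ne_zero
    rw [hαq, eq_div_iff hden, mul_comm]
    exact h'
  -- hence `x^{1/1} = (Z₀^num)^{1/den}`, a root of a base-field-theoretic element
  have hxeq : Perfection.of (C.divisorMonoid.obj (op W)) x = Perfection.mk (Z₀ ^ ρ.num) qd :=
    hXinj _ _ fun 𝔮 => by rw [hXx, hroot, hαpq]
  rw [← of_mem_bsFldPf_iff x, hxeq]
  exact ⟨Z₀ ^ ρ.num, qd, isBaseFieldTheoreticDiv_pow hZ₀b _, rfl⟩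

/-! ### §5 Part (d) and row C38-L05 at the tree vocabulary, without `hSup` -/

/-- **Part (d) of row C38-L05 at the tree vocabulary, WITHOUT the binder `hSup`**: for `x ∈ Φ(W)`, `x` is
base-field-theoretic iff `x^{1/1}` is the supremum, for divisibility in `Φ(W)^pf`, of a nonempty directed family of
roots of O^▷-divisors dividing it — GIVEN `hP34Λ` (Prop. 3.4 (ii) at monoid type `Λ`, = the typed field
`Prop34Cnst.mem_FΛ_of_divΛ_eq_of`), `hNZ` (Def. 3.6 (ii)(b), bracketed consequence), and the side conditions
`hΛ` (`Φ^{bs-fld}(W)` of type `ℤ` or `ℚ`) and `hQ` (`Φ(W)` has `ℚ`-monoprime localized perfections).  (⇒): the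
family `{x^{1/1}}` (commensurability with `Z₀`); (⇐): the coordinate argument `isBaseFieldTheoreticDiv_of_isLUB_bsFldPf`.
[cite: MochizukiEtTh2009, Cor 3.8 p.81] -/
theorem isBaseFieldTheoreticDiv_iff_isLUB_divOPf_coord
    (hP34Λ : ∀ (Y : D₀ᵒᵖ) (b : T'.BΛ.obj Y) (r : T'.ΦR.obj Y),
      T'.divΛ Y b = Algebra.GrothendieckGroup.of r → b ∈ T'.FΛ Y)
    (hNZ : ∀ A : Dᵒᵖ, ∃ u : (T'.BΛ.obj (C.baseOp A) : Type w) × Algebra.GrothendieckGroup (C.Φ.carrier A),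
      u ∈ C.cnstFn A ∧ ∃ Z : C.Φ.carrier A, Z ≠ 1 ∧ u.2 = Algebra.GrothendieckGroup.of Z)
    {W : D} (hΛ : IsZMonoprime ↥(C.bsFld.carrier (op W)) ∨ IsQMonoprime ↥(C.bsFld.carrier (op W)))
    (hQ : ∀ 𝔮 : Primes (Perfection (C.divisorMonoid.obj (op W))),
      IsQMonoprime (PfAt (C.divisorMonoid.obj (op W)) 𝔮))
    (x : C.divisorMonoid.obj (op W)) :
    C.IsBaseFieldTheoreticDiv x ↔
      ∃ S : Set (Perfection (C.divisorMonoid.obj (op W))), S ⊆ C.divOPf W ∧ S.Nonempty ∧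
        DirectedOn (fun a b => a ∣ b) S ∧ (∀ s ∈ S, s ∣ Perfection.of _ x) ∧
        ∀ z, (∀ s ∈ S, s ∣ z) → Perfection.of _ x ∣ z := by
  obtain ⟨Z₀, hZ₀, hZ₀b, hZ₀1⟩ := exists_divO_ne_one hNZ W
  constructor
  · intro hx
    refine ⟨{Perfection.of _ x}, ?_, Set.singleton_nonempty _, ?_, ?_, ?_⟩
    · rintro _ rfl
      exact of_mem_divOPf_of_isBaseFieldTheoreticDiv hΛ hZ₀ hZ₀b hZ₀1 hx
    · rintro _ rfl _ rfl
      exact ⟨_, rfl, dvd_rfl, dvd_rfl⟩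
    · rintro _ rfl
      exact dvd_rfl
    · intro z hz
      exact hz _ rfl
  · rintro ⟨S, hS, hne, -, hbd, hlub⟩
    exact isBaseFieldTheoreticDiv_of_isLUB_bsFldPf hΛ hQ hZ₀b hZ₀1 x
      (hS.trans (divOPf_subset_bsFldPf hP34Λ W)) hne hbd hlub

variable (C) in
/-- **Row C38-L05 of the [EtTh] Cor. 3.8 sub-DAG at the tree vocabulary, WITHOUT `hSup`** (proof of Cor. 3.8, PDF
p.81 l.20–27): for THE perfection of the Frobenioid of a tempered Frobenioid over Def. 3.6 (i) data with the tree's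
monoid vocabulary, a pre-step is base-field-theoretic if and only if its image in `C^pf` is a cofiltered limit, in
`(C^pf)^coa-pre_B`, of pre-steps abstractly equivalent to an element of some `O^▷(−)` — GIVEN the printed properties
`hP34Λ`, `hNZ` of the Def. 3.3/3.6 (i) data and the side conditions `hΛ`, `hQ` (monoid type `Λ ∈ {ℤ, ℚ}` of the line
and `ℚ`-monoprime localized perfections of the divisor monoids; compare `bsFldPreStepLimitCriterion_of`, which
instead binds `hSup`). [cite: MochizukiEtTh2009, Cor 3.8 p.81] -/
theorem bsFldPreStepLimitCriterion_of_coord (hF : PreFrobenioid.IsFrobenioid C.toElem)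
    (hP34Λ : ∀ (Y : D₀ᵒᵖ) (b : T'.BΛ.obj Y) (r : T'.ΦR.obj Y),
      T'.divΛ Y b = Algebra.GrothendieckGroup.of r → b ∈ T'.FΛ Y)
    (hNZ : ∀ A : Dᵒᵖ, ∃ u : (T'.BΛ.obj (C.baseOp A) : Type w) × Algebra.GrothendieckGroup (C.Φ.carrier A),
      u ∈ C.cnstFn A ∧ ∃ Z : C.Φ.carrier A, Z ≠ 1 ∧ u.2 = Algebra.GrothendieckGroup.of Z)
    (hΛ : ∀ W : D, IsZMonoprime ↥(C.bsFld.carrier (op W)) ∨ IsQMonoprime ↥(C.bsFld.carrier (op W)))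
    (hQ : ∀ (W : D) (𝔮 : Primes (Perfection (C.divisorMonoid.obj (op W)))),
      IsQMonoprime (PfAt (C.divisorMonoid.obj (op W)) 𝔮)) :
    C.BsFldPreStepLimitCriterion (PreFrobenioidData.perfection hF) := by
  intro A B φ hφ
  have hψ : (PreFrobenioidData.perfection hF).ops.IsCoAngularPreStep ((PreFrobenioidData.perfection hF).toPf.map φ) :=
    Cor38Criterion.isCoAngularPreStep_of_isPreStep (PreFrobenioid.Perfection.preservesMor_isPreStep hF φ hφ)
  rw [Cor38Criterion.isLimitOfOTriLike_iff_isLUB_divOPf _ hψ, sliceDiv_toPf hF φ hφ.2 hψ,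
    isBaseFieldTheoretic_iff_invDiv φ hφ.2]
  exact isBaseFieldTheoreticDiv_iff_isLUB_divOPf_coord hP34Λ hNZ (hΛ _) (hQ _) _

end Tree

end TemperedFrobenioid

/-! ### v2 (append-only, seat abc-iut-w4-d084 gen 3): the side condition `hΛ` FOLLOWS from `hQ` and `hNZ`

If the divisor monoid `Φ(W)` has `ℚ`-monoprime localized perfections (`hQ`) and `Φ^{bs-fld}(W)` has a nontrivial
element (`hNZ`), then the monoprime monoid `Φ^{bs-fld}(W)` (typed field `isMonoprime_bsFld`) is NOT of type `ℝ`: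
an `ℝ`-line through `Z₀` inside `Φ(W)` would contain `Z₀^{√2}`, whose coordinate at a prime where `Z₀` is visible
is `√2 ·` (a rational multiple of the chart constant) — not a rational multiple.  Hence the C38-L05 residual at the
tree vocabulary is `{hP34Λ (= the typed field), hNZ, hQ}`: `bsFldPreStepLimitCriterion_of_coord'`. -/

namespace TemperedFrobenioid

section TreeV2

variable {T' : RealifiedDivisorMonoids (D₀ := D₀) treeMonoidVocab.{w}} {C : TemperedFrobenioid T' D VD}

/-- **`Φ^{bs-fld}(W)` is not `ℝ`-monoprime** when `Φ(W)` has `ℚ`-monoprime localized perfections and a nontrivial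
base-field-theoretic element `Z₀`: in the coordinates of [FrdI] Def. 2.4 (i) the would-be `ℝ`-line `t ↦ Z₀^t`
through `Z₀` has coordinates `t · κ(Z₀)` (monotone + additive + `κ(Z₀^n) = n·κ(Z₀)`), and at a prime where
`κ(Z₀) ≠ 0` all coordinates are rational multiples of one constant (`hQ`), so `t = √2` is impossible.
[cite: MochizukiFrdI2008, Def. 2.4(i) p.47] -/
theorem not_isRMonoprime_bsFld {W : D}
    (hQ : ∀ 𝔮 : Primes (Perfection (C.divisorMonoid.obj (op W))),
      IsQMonoprime (PfAt (C.divisorMonoid.obj (op W)) 𝔮))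
    {Z₀ : C.divisorMonoid.obj (op W)} (hZ₀b : C.IsBaseFieldTheoreticDiv Z₀) (hZ₀1 : Z₀ ≠ 1) :
    ¬ IsRMonoprime ↥(C.bsFld.carrier (op W)) := by
  rintro ⟨⟨e⟩⟩
  classical
  have hM : IsPerfFactorial (C.divisorMonoid.obj (op W)) := isPerfFactorial_divisorMonoid W
  obtain ⟨κ, hinj, hord, hrat⟩ := Cor38Coord.exists_pfCoord hM
  -- additive coordinates (as in §4)
  let X : Perfection (C.divisorMonoid.obj (op W)) → Primes (Perfection (C.divisorMonoid.obj (op W))) → ℝ≥0 :=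
    fun a 𝔮 => Multiplicative.toAdd (κ a 𝔮)
  have hXpow : ∀ a (n : ℕ) 𝔮, X (a ^ n) 𝔮 = n * X a 𝔮 := by
    intro a n 𝔮
    change Multiplicative.toAdd (κ (a ^ n) 𝔮) = n * Multiplicative.toAdd (κ a 𝔮)
    rw [map_pow, Pi.pow_apply, toAdd_pow, nsmul_eq_mul]
  have hXle : ∀ a b, a ∣ b ↔ ∀ 𝔮, X a 𝔮 ≤ X b 𝔮 := by
    intro a b
    rw [hord a b, Pi.le_def]
    exact forall_congr' fun 𝔮 => (Multiplicative.toAdd_le).symm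
  have hXinj : ∀ a b, (∀ 𝔮, X a 𝔮 = X b 𝔮) → a = b := by
    intro a b h
    exact hinj (funext fun 𝔮 => Multiplicative.toAdd.injective (h 𝔮))
  let w : Primes (Perfection (C.divisorMonoid.obj (op W))) → ℝ≥0 :=
    X (Perfection.of (C.divisorMonoid.obj (op W)) Z₀)
  have hw0 : ∃ 𝔮₀, w 𝔮₀ ≠ 0 := by
    by_contra hall
    apply hZ₀1
    have h1 : Perfection.of (C.divisorMonoid.obj (op W)) Z₀ = 1 :=
      hXinj _ _ fun 𝔮 => by
        have hw : w 𝔮 = 0 := not_not.mp (not_exists.mp hall 𝔮)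
        change w 𝔮 = Multiplicative.toAdd (κ 1 𝔮)
        rw [map_one, Pi.one_apply, toAdd_one]
        exact hw
    exact (Perfection.mk_eq_one_iff_of_isSharp hM.isDivisorial.isSharp).mp h1
  obtain ⟨𝔮₀, h𝔮₀⟩ := hw0
  -- the would-be `ℝ`-line through `Z₀`: `ψ(t) = e⁻¹(t · e(Z₀))`, a homomorphism `ℝ_{≥0} → Φ(W)` with `ψ(1) = Z₀`
  let Zb : ↥(C.bsFld.carrier (op W)) := ⟨_, hZ₀b⟩
  let s₀ : ℝ≥0 := Multiplicative.toAdd (e Zb)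
  let ψ : Multiplicative ℝ≥0 →* C.divisorMonoid.obj (op W) :=
    (Submonoid.inclusion (C.bsFld_le (op W))).comp
      (e.symm.toMonoidHom.comp (AddMonoidHom.toMultiplicative (AddMonoidHom.mulLeft s₀)))
  have hψ : ∀ t : ℝ≥0, ψ (Multiplicative.ofAdd t) =
      Submonoid.inclusion (C.bsFld_le (op W)) (e.symm (Multiplicative.ofAdd (s₀ * t))) := fun _ => rfl
  have hψ1 : ψ (Multiplicative.ofAdd 1) = Z₀ := by
    rw [hψ, mul_one]
    have h2 : e.symm (Multiplicative.ofAdd s₀) = Zb := by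
      rw [MulEquiv.symm_apply_eq]
      exact (ofAdd_toAdd _).symm
    rw [h2]
    exact Subtype.ext rfl
  -- its coordinates: `G t := X (ψ t)`; monotone, `G (n • t) = n • G t`, `G 1 = w`
  let G : ℝ≥0 → Primes (Perfection (C.divisorMonoid.obj (op W))) → ℝ≥0 :=
    fun t => X (Perfection.of (C.divisorMonoid.obj (op W)) (ψ (Multiplicative.ofAdd t)))
  have hGmono : ∀ {t t' : ℝ≥0}, t ≤ t' → ∀ 𝔮, G t 𝔮 ≤ G t' 𝔮 := by
    intro t t' htt'
    refine (hXle _ _).mp (map_dvd _ (map_dvd ψ ?_))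
    exact (RealificationCoord.mnnreal_dvd_iff_le _ _).mpr htt'
  have hGnat : ∀ (p : ℕ) (N : ℕ+) 𝔮, G ((p : ℝ≥0) / (N : ℕ)) 𝔮 = (p : ℝ≥0) / (N : ℕ) * w 𝔮 := by
    intro p N 𝔮
    have hN : ((N : ℕ) : ℝ≥0) ≠ 0 := by exact_mod_cast N.ne_zero
    have h1 : (Multiplicative.ofAdd ((p : ℝ≥0) / (N : ℕ))) ^ (N : ℕ) = (Multiplicative.ofAdd (1 : ℝ≥0)) ^ p := by
      rw [← ofAdd_nsmul, ← ofAdd_nsmul, nsmul_eq_mul, nsmul_eq_mul, mul_one, mul_div_cancel₀ _ hN]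
    have h2 := congrArg (fun m => X (Perfection.of (C.divisorMonoid.obj (op W)) (ψ m)) 𝔮) h1
    simp only [map_pow, hXpow] at h2
    rw [hψ1] at h2
    -- `h2 : N * G (p/N) 𝔮 = p * w 𝔮`
    rw [div_mul_eq_mul_div, eq_div_iff hN, mul_comm]
    exact h2
  -- hence `G t = t · w` for every real `t ≥ 0` (squeeze between `⌊tN⌋/N` and `(⌊tN⌋+1)/N`)
  have hGt : ∀ (t : ℝ≥0) 𝔮, G t 𝔮 = t * w 𝔮 := by
    intro t 𝔮
    have key : ∀ N : ℕ, 0 < N →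
        G t 𝔮 ≤ t * w 𝔮 + w 𝔮 / N ∧ t * w 𝔮 ≤ G t 𝔮 + w 𝔮 / N := by
      intro N hN
      let N' : ℕ+ := ⟨N, hN⟩
      have hNN : ((N' : ℕ) : ℝ≥0) = (N : ℝ≥0) := rfl
      have hNpos : (0 : ℝ≥0) < (N : ℝ≥0) := by exact_mod_cast hN
      let p : ℕ := ⌊t * N⌋₊
      have hlo : (p : ℝ≥0) / N ≤ t := by
        rw [div_le_iff₀ hNpos]
        exact Nat.floor_le zero_le
      have hhi : t ≤ ((p + 1 : ℕ) : ℝ≥0) / N := by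
        rw [le_div_iff₀ hNpos]
        push_cast
        exact (Nat.lt_floor_add_one _).le
      have hhi' : ((p + 1 : ℕ) : ℝ≥0) / N ≤ t + 1 / N := by
        rw [div_le_iff₀ hNpos, add_mul, one_div, inv_mul_cancel₀ hNpos.ne']
        push_cast
        exact add_le_add (Nat.floor_le zero_le) le_rfl
      have hlo' : t ≤ (p : ℝ≥0) / N + 1 / N := by
        rw [← add_div, le_div_iff₀ hNpos]
        push_cast at hhi ⊢
        rw [le_div_iff₀ hNpos] at hhi
        exact hhi
      constructor
      · calc G t 𝔮 ≤ G (((p + 1 : ℕ) : ℝ≥0) / (N' : ℕ)) 𝔮 := hGmono (hNN ▸ hhi) 𝔮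
          _ = ((p + 1 : ℕ) : ℝ≥0) / (N' : ℕ) * w 𝔮 := hGnat (p + 1) N' 𝔮
          _ ≤ (t + 1 / N) * w 𝔮 := mul_le_mul_of_nonneg_right (hNN ▸ hhi') zero_le
          _ = t * w 𝔮 + w 𝔮 / N := by rw [add_mul, one_div, inv_mul_eq_div]
      · calc t * w 𝔮 ≤ ((p : ℝ≥0) / N + 1 / N) * w 𝔮 := mul_le_mul_of_nonneg_right hlo' zero_le
          _ = (p : ℝ≥0) / (N' : ℕ) * w 𝔮 + w 𝔮 / N := by rw [add_mul, one_div, inv_mul_eq_div, hNN]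
          _ = G ((p : ℝ≥0) / (N' : ℕ)) 𝔮 + w 𝔮 / N := by rw [hGnat p N' 𝔮]
          _ ≤ G t 𝔮 + w 𝔮 / N := add_le_add (hGmono (hNN ▸ hlo) 𝔮) le_rfl
    exact le_antisymm (nnreal_le_of_forall_le_add_div fun N hN => (key N hN).1)
      (nnreal_le_of_forall_le_add_div fun N hN => (key N hN).2)
  -- at `𝔮₀` all coordinates are rational multiples of `c`; apply to `t = √2`
  obtain ⟨c, hc, hcq⟩ := hrat 𝔮₀ (hQ 𝔮₀)
  obtain ⟨q₂, hq₂⟩ := hcq (Perfection.of (C.divisorMonoid.obj (op W)) Z₀)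
  change w 𝔮₀ = c * q₂ at hq₂
  have hq₂0 : q₂ ≠ 0 := by
    intro h; apply h𝔮₀; rw [hq₂, h, NNRat.cast_zero, mul_zero]
  have hq₂0' : ((q₂ : ℚ≥0) : ℝ≥0) ≠ 0 := by exact_mod_cast hq₂0
  let t : ℝ≥0 := ⟨Real.sqrt 2, Real.sqrt_nonneg 2⟩
  obtain ⟨q, hq⟩ := hcq (Perfection.of (C.divisorMonoid.obj (op W)) (ψ (Multiplicative.ofAdd t)))
  change G t 𝔮₀ = c * q at hq
  rw [hGt, hq₂, ← mul_assoc, mul_comm t c, mul_assoc] at hq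
  have ht : t = ((q / q₂ : ℚ≥0) : ℝ≥0) := by
    rw [NNRat.cast_div, eq_div_iff hq₂0']
    exact mul_left_cancel₀ hc hq
  refine irrational_sqrt_two ⟨((q / q₂ : ℚ≥0) : ℚ), ?_⟩
  have ht' : ((t : ℝ≥0) : ℝ) = Real.sqrt 2 := rfl
  rw [← ht', ht]
  push_cast
  rfl

/-- **`hΛ` from `hQ` and a nontrivial base-field-theoretic element**: `Φ^{bs-fld}(W)` (monoprime by the typed
field `isMonoprime_bsFld`) is of type `ℤ` or `ℚ`. [cite: MochizukiEtTh2009, Def 3.6 p.77] -/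
theorem isZQMonoprime_bsFld {W : D}
    (hQ : ∀ 𝔮 : Primes (Perfection (C.divisorMonoid.obj (op W))),
      IsQMonoprime (PfAt (C.divisorMonoid.obj (op W)) 𝔮))
    {Z₀ : C.divisorMonoid.obj (op W)} (hZ₀b : C.IsBaseFieldTheoreticDiv Z₀) (hZ₀1 : Z₀ ≠ 1) :
    IsZMonoprime ↥(C.bsFld.carrier (op W)) ∨ IsQMonoprime ↥(C.bsFld.carrier (op W)) := by
  rcases C.isMonoprime_bsFld (op W) with hZ | hQ' | hR
  · exact Or.inl hZ
  · exact Or.inr hQ'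
  · exact absurd hR (not_isRMonoprime_bsFld hQ hZ₀b hZ₀1)

variable (C) in
/-- **Row C38-L05 at the tree vocabulary WITHOUT `hSup` AND WITHOUT `hΛ`**: `C.BsFldPreStepLimitCriterion` for THE
perfection, GIVEN only `hF`, `hP34Λ` (the typed field of the Def. 3.3 data), `hNZ` (Def. 3.6 (ii)(b)) and `hQ`
(`ℚ`-monoprime localized perfections of the divisor monoids) — `hΛ` being a CONSEQUENCE (`isZQMonoprime_bsFld`).
[cite: MochizukiEtTh2009, Cor 3.8 p.81] -/
theorem bsFldPreStepLimitCriterion_of_coord' (hF : PreFrobenioid.IsFrobenioid C.toElem)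
    (hP34Λ : ∀ (Y : D₀ᵒᵖ) (b : T'.BΛ.obj Y) (r : T'.ΦR.obj Y),
      T'.divΛ Y b = Algebra.GrothendieckGroup.of r → b ∈ T'.FΛ Y)
    (hNZ : ∀ A : Dᵒᵖ, ∃ u : (T'.BΛ.obj (C.baseOp A) : Type w) × Algebra.GrothendieckGroup (C.Φ.carrier A),
      u ∈ C.cnstFn A ∧ ∃ Z : C.Φ.carrier A, Z ≠ 1 ∧ u.2 = Algebra.GrothendieckGroup.of Z)
    (hQ : ∀ (W : D) (𝔮 : Primes (Perfection (C.divisorMonoid.obj (op W)))),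
      IsQMonoprime (PfAt (C.divisorMonoid.obj (op W)) 𝔮)) :
    C.BsFldPreStepLimitCriterion (PreFrobenioidData.perfection hF) :=
  bsFldPreStepLimitCriterion_of_coord C hF hP34Λ hNZ
    (fun W => by
      obtain ⟨Z₀, -, hZ₀b, hZ₀1⟩ := exists_divO_ne_one hNZ W
      exact isZQMonoprime_bsFld (hQ W) hZ₀b hZ₀1)
    hQ

end TreeV2

end TemperedFrobenioid

end Literature.AnabelianGeometry.EtaleTheta
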